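import Literature.NumberTheory.Automorphic.ResGLnCohomologyRationalRelations
import Literature.NumberTheory.Automorphic.ClozelAlgebraicityHeckeFieldResProofs
import Literature.FieldTheory.AlgClosed.AutStableSubspaceDescent
import Literature.FieldTheory.AlgClosed.PadicAlgClEquivComplex
import Mathlib.LinearAlgebra.FreeModule.PID
import HarnessLib

/-!
# Hecke relations on `H^•(Res_{K/ℚ} GL_n)` with parallel weights are defined over `ℤ` (proofs)

Proofs-only companion (theorems only: no definition, no named fact, no instance) of
`ResGLnCohomologyRationalRelations.lean`: it DISCHARGES the named fact
`ResGLnCohomology.heckeRelations_definedOverInt` (`heckeRelations_definedOverInt_holds`): for any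
number field `K`, any `n`, a prime `p`, a level `𝔫`, finitely many receptacles
`M_k = H^{q_k}(S_{K_f(𝔫)}, Ẽ_{λ_k}(ℚ̄_p))` (`ResGLnCohomology.levelCohomology (PadicAlgCl p) …`) with
PARALLEL weights and letters `X_j ↦ T_{v_j,i_j}`, every `p`-adically integral non-commutative
polynomial relation `P(T) = 0` on the family is `Σ_i c_i Q_i` with `‖c_i‖ ≤ 1` and integer relations
`Q_i ∈ ℤ⟨X⟩`.

## The printed argument and the argument formalised

Grobner–Raghuram (2014, arXiv:1102.1872 numbering) prove that `E_μ` is defined over its rationality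
field `ℚ(μ)` (§7.1 Lemma 37, after Clozel 1990, p. 122) — for a parallel `μ` every `σ ∈ Aut(ℂ)`
permutes the factors of `E_μ = ⊗_v E_{μ_v}`, so `^σE_μ ≅ E_μ`, `𝔖(E_μ) = Aut(ℂ)` and `ℚ(μ) = ℚ` — and
that the `G'(𝔸_f)`-modules `H^q(S_{G'}, ℰ_μ)` are defined over `ℚ(μ)` (§7.2 Lemma 38); they also
record (§7.2, display after Lemma 38) the natural `σ`-linear `G'(𝔸_f)`-equivariant isomorphisms
`σ^* : H^q(S_{G'}, ℰ_μ) → H^q(S_{G'}, ^σℰ_μ)` for all `σ ∈ Aut(ℂ)`.  It is this last mechanism that is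
formalised here, on the tree's model `H^q(GL_n(K)⁺, Fun(GL_n(𝔸_K^∞)/K_f(𝔫), ⊗_τ V_μ(ℚ̄_p)))`
(Mathlib `groupCohomology`), where it needs neither a `ℚ`-form of the coefficients nor a comparison
with Betti cohomology nor any finiteness (Borel–Serre):

1. (`exists_semilinear_heckeSymmetry`) for `σ ∈ Aut(ℚ̄_p)` and a CONSTANT weight `τ ↦ μ`, the
   `σ`-semilinear self-map `⊗_τ w_τ ↦ ⊗_{τ'} σ̃(w_{σ⁻¹τ'})` of `E = ⊗_{τ : K →+* ℚ̄_p} V_μ(ℚ̄_p)` (`σ̃` the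
   coordinatewise conjugation of the Weyl module, `weylSemimap`; the factor at `τ` is moved to
   `σ ∘ τ`, `PiTensorProduct.reindex`) commutes with `GL_n(K)` (`σ(τ g) = (στ) g`) and is inverted
   by the same map for `σ⁻¹`; by `TwistedQuotient.cohomologySemimap` it induces a SURJECTIVE
   `σ`-semilinear `θ_σ = σ^*` on `H^q(S_{K_f(𝔫)}, Ẽ)` commuting with every `[K_f(𝔫) g K_f(𝔫)]`
   [cite: GrobnerRaghuram2014, §7.2 (σ^*, after Lemma 38)];
2. hence the finite-dimensional space of coefficient vectors `v ∈ ℚ̄_p^S` (`S` = the words of `P`)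
   with `Σ_w v_w T^w = 0` on every `M_k` is stable under `v ↦ σ ∘ v` (`θ_σ ∘ P(T) = (σP)(T) ∘ θ_σ`);
3. an `Aut(ℚ̄_p)`-stable subspace of `ℚ̄_p^S` is spanned by its rational vectors — Galois descent of
   subspaces [cite: Borel1991, AG §14.2], the tree's `Complex.submodule_le_span_fixed_of_forall_ringEquiv`
   transported along an abstract field isomorphism `ℚ̄_p ≃ ℂ` (`PadicAlgCl.nonempty_ringEquiv_complex`);
4. (`exists_int_combination_of_mem_span_rat`) integral refinement: the integer vectors `Λ ⊆ ℤ^S` of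
   such a subspace `V` form a SATURATED sublattice, hence (Smith normal form over the PID `ℤ`) a direct
   summand with a projection `π : ℤ^S → ℤ^S`, `ker π ⊇ Λ`, `z − π z ∈ Λ`; its scalar extension kills the
   rational vectors of `V`, so every `v ∈ V ∩ span(rational vectors)` is `v = Σ_s v_s (e_s − π e_s)` —
   an explicit combination of INTEGER vectors of `V` whose coefficients are the coordinates `v_s`
   themselves (so `p`-adically integral when `P` is) [folklore];
5. glue: a free-algebra element is the sum of its monoid-algebra coefficients times words
   (`FreeAlgebra.equivMonoidAlgebraFreeMonoid`), words evaluate alike under `FreeAlgebra.lift` and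
   `FreeRing.lift`, and parallel weights `λ_k` are constant in `τ` (an embedding `K →+* ℚ̄_p` exists).

## References

* H. Grobner, A. Raghuram, *On some arithmetic properties of automorphic forms of GL_m over a
  division algebra*, Int. J. Number Theory 10 (2014) = arXiv:1102.1872, §7.1 Lemma 37, §7.2
  Lemma 38 and the isomorphisms `σ^*` (held; read 2026-08-17, PDF p. 21). [GrobnerRaghuram2014]
* L. Clozel, *Motifs et formes automorphes: applications du principe de fonctorialité* (1990),
  §3.5, p. 122 (`σ^*`). [Clozel1990]
* A. Borel, *Linear Algebraic Groups*, 2nd ed. (1991), AG §14.2 (Galois descent of subspaces). [Borel1991]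
-/

noncomputable section

open scoped TensorProduct
open Cardinal NumberField IsDedekindDomain

namespace Literature.NumberTheory.Automorphic

namespace ResGLnCohomology

open GLnCohomology Literature.LinearAlgebra.Semilinear Literature.NumberTheory.DiophantineGeometry
  Literature.FieldTheory.AlgClosed

/-! ### 1. The `Aut(k)`-symmetry of `H^q(S_{K_f(𝔫)}, Ẽ_μ(k))` for a constant weight -/

section Symmetry

variable {k : Type} [Field k]

/-- **The `σ`-semilinear Hecke-equivariant symmetry `σ^*` of `H^q(S_{K_f(𝔫)}, Ẽ_μ(k))` for a weight
constant in the embedding.** For a field automorphism `σ` of `k` and `E = ⊗_{τ : K →+* k} V_μ(k)`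
(`ResGLnCohomology.CoeffModule k n K (fun _ => μ)`), the map `⊗_τ w_τ ↦ ⊗_{τ'} σ̃ (w_{σ⁻¹ ∘ τ'})` (`σ̃`
the coordinatewise `σ`-conjugation `weylSemimap σ` of `V_μ(k)`, intertwining `V_μ(g)` and `V_μ(σ g)`;
factors permuted by `PiTensorProduct.reindex` along `τ ↦ σ ∘ τ`) is `σ`-semilinear, commutes with
`GL_n(K)` (as `σ((σ⁻¹τ') g) = τ' g`) and is inverted by the same map for `σ⁻¹`; the induced map
`θ_σ = H^q(⊗)` on `H^q(GL_n(K)⁺, Fun(GL_n(𝔸_K^∞)/K_f(𝔫), E))` (`TwistedQuotient.cohomologySemimap`) is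
`σ`-semilinear, SURJECTIVE, and commutes with every Hecke operator `[K_f(𝔫) g K_f(𝔫)]` (`heckeOp`).
In print: the `σ`-linear `G'(𝔸_f)`-equivariant isomorphisms `σ^* : H^q(S_{G'}, ℰ_μ) → H^q(S_{G'}, ^σℰ_μ)`
with `^σE_μ = ⊗_v E_{μ_{σ⁻¹v}} = E_μ` for parallel `μ`.
[cite: GrobnerRaghuram2014, §7.2 (σ^*, after Lemma 38) and §7.1 Lemma 37] -/
theorem exists_semilinear_heckeSymmetry (σ : k ≃+* k) (n : ℕ) (K : Type) [Field K]
    [NumberField K] (𝔫 : Ideal (𝓞 K)) (μ : Fin n → ℤ) (q : ℕ) :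
    ∃ θ : levelCohomology k n K 𝔫 (fun _ => μ) q →ₛₗ[(σ : k →+* k)]
        levelCohomology k n K 𝔫 (fun _ => μ) q,
      Function.Surjective θ ∧
      ∀ (g : BigHeckeGLn.FiniteAdelicGL n K) (x : levelCohomology k n K 𝔫 (fun _ => μ) q),
        θ (heckeOp k n K 𝔫 (fun _ => μ) q g x) = heckeOp k n K 𝔫 (fun _ => μ) q g (θ x) := by
  classical
  -- `τ ↦ ρ ∘ τ` on the embeddings `K →+* k`
  let e : (k ≃+* k) → (K →+* k) ≃ (K →+* k) := fun ρ =>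
    { toFun := fun τ => (ρ : k →+* k).comp τ
      invFun := fun τ => (ρ.symm : k →+* k).comp τ
      left_inv := fun τ => RingHom.ext fun x => by simp
      right_inv := fun τ => RingHom.ext fun x => by simp }
  -- the `ρ`-conjugation of the factor `V_μ(k)`
  let s : ∀ ρ : k ≃+* k,
      GLnCohomology.CoeffModule k n μ →ₛₗ[(ρ : k →+* k)] GLnCohomology.CoeffModule k n μ :=
    fun ρ => (weylSemimap (ρ : k →+* k) (Fin n) (coeffPartition μ) :
      GLnCohomology.CoeffModule k n μ →ₛₗ[(ρ : k →+* k)] GLnCohomology.CoeffModule k n μ)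
  -- the `ρ`-conjugation of `E = ⊗_τ V_μ(k)`: conjugate each factor and move it from `τ` to `ρ ∘ τ`
  let S : ∀ ρ : k ≃+* k,
      ResGLnCohomology.CoeffModule k n K (fun _ => μ) →ₛₗ[(ρ : k →+* k)]
        ResGLnCohomology.CoeffModule k n K (fun _ => μ) := fun ρ =>
    ((PiTensorProduct.reindex k (fun _ : (K →+* k) => GLnCohomology.CoeffModule k n μ) (e ρ) :
        ResGLnCohomology.CoeffModule k n K (fun _ => μ) ≃ₗ[k]
          ResGLnCohomology.CoeffModule k n K (fun _ => μ)).toLinearMap.comp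
      (PiTensorProduct.semimap (fun _ : (K →+* k) => s ρ) :
        ResGLnCohomology.CoeffModule k n K (fun _ => μ) →ₛₗ[(ρ : k →+* k)]
          ResGLnCohomology.CoeffModule k n K (fun _ => μ)))
  have hS_tprod : ∀ (ρ : k ≃+* k) (w : (K →+* k) → GLnCohomology.CoeffModule k n μ),
      S ρ (CoeffModule.tprod w) = CoeffModule.tprod fun τ => s ρ (w ((e ρ).symm τ)) := by
    intro ρ w
    show PiTensorProduct.reindex k (fun _ : (K →+* k) => GLnCohomology.CoeffModule k n μ) (e ρ)
      (PiTensorProduct.semimap (fun _ : (K →+* k) => s ρ) (PiTensorProduct.tprod k w)) = _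
    rw [PiTensorProduct.semimap_tprod, PiTensorProduct.reindex_tprod]
    rfl
  -- `ρ ((ρ⁻¹τ) g) = τ g`
  have hmap : ∀ (ρ : k ≃+* k) (τ : K →+* k) (g : GL (Fin n) K),
      Matrix.GeneralLinearGroup.map (ρ : k →+* k)
        (Matrix.GeneralLinearGroup.map ((e ρ).symm τ) g) = Matrix.GeneralLinearGroup.map τ g := by
    intro ρ τ g
    ext i j
    simp [e, Matrix.GeneralLinearGroup.map_apply]
  -- equivariance for `GL_n(K)⁺`
  have hS_equiv : ∀ (ρ : k ≃+* k) (γ : glTotPos n K)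
      (v : ResGLnCohomology.CoeffModule k n K (fun _ => μ)),
      S ρ (coeffRepPos k n K (fun _ => μ) γ v) = coeffRepPos k n K (fun _ => μ) γ (S ρ v) := by
    intro ρ γ v
    induction v using CoeffModule.induction_on with
    | smul_tprod c w =>
      rw [map_smul, map_smulₛₗ, map_smulₛₗ, map_smul, coeffRepPos_apply, coeffRep_apply_tprod,
        hS_tprod, hS_tprod, coeffRep_apply_tprod]
      congr 1
      congr 1
      funext τ
      show (weylSemimap (ρ : k →+* k) (Fin n) (coeffPartition μ) :
          GLnCohomology.CoeffModule k n μ →ₛₗ[(ρ : k →+* k)] GLnCohomology.CoeffModule k n μ)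
        (coeffRepGL k n μ _ (w ((e ρ).symm τ))) = _
      rw [weylSemimap_coeffRepGL, hmap]
      rfl
    | add x y hx hy => rw [map_add, map_add, hx, hy, map_add, map_add]
  -- inverse pairs `S ρ' ∘ S ρ = id` when `ρ' ∘ ρ = id`
  have hSS : ∀ (ρ ρ' : k ≃+* k), (∀ c, ρ' (ρ c) = c) →
      ∀ v : ResGLnCohomology.CoeffModule k n K (fun _ => μ), S ρ' (S ρ v) = v := by
    intro ρ ρ' h v
    have hidx : ∀ τ : K →+* k, (e ρ).symm ((e ρ').symm τ) = τ := fun τ => RingHom.ext fun x => by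
      show ρ.symm (ρ'.symm (τ x)) = τ x
      have h1 := h (ρ.symm (ρ'.symm (τ x)))
      rw [RingEquiv.apply_symm_apply, RingEquiv.apply_symm_apply] at h1
      exact h1.symm
    induction v using CoeffModule.induction_on with
    | smul_tprod c w =>
      rw [map_smulₛₗ, map_smulₛₗ, hS_tprod, hS_tprod]
      have hc : ((ρ' : k →+* k) ((ρ : k →+* k) c)) = c := h c
      rw [hc]
      congr 1
      congr 1
      funext τ
      show s ρ' (s ρ (w ((e ρ).symm ((e ρ').symm τ)))) = w τ
      rw [hidx]
      exact weylSemimap_weylSemimap_coeffModule _ _ h n μ (w τ)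
    | add x y hx hy => rw [map_add, map_add, hx, hy]
  refine ⟨TwistedQuotient.cohomologySemimap (diagPos n K) (level n K 𝔫)
      (coeffRepPos k n K (fun _ => μ)) (coeffRepPos k n K (fun _ => μ)) (S σ) (hS_equiv σ) q,
    ?_, fun g x => ?_⟩
  · exact TwistedQuotient.cohomologySemimap_surjective_of_rightInverse (diagPos n K) (level n K 𝔫)
      (coeffRepPos k n K (fun _ => μ)) (coeffRepPos k n K (fun _ => μ)) (S σ) (hS_equiv σ)
      (S σ.symm) (hS_equiv σ.symm) (fun v => hSS σ.symm σ (fun c => σ.apply_symm_apply c) v) q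
  · exact TwistedQuotient.cohomologySemimap_heckeEnd (diagPos n K) (level n K 𝔫)
      (coeffRepPos k n K (fun _ => μ)) (coeffRepPos k n K (fun _ => μ)) (S σ) (hS_equiv σ) g q x

end Symmetry

/-! ### 2. Words, and semilinear maps commuting with the letters -/

section Words

variable (R : Type*) [CommSemiring R] {X : Type*}

/-- The word `w`, multiplied out in the free algebra (`FreeMonoid.lift (FreeAlgebra.ι R) w`),
corresponds to the monomial `w` of the monoid algebra `R[FreeMonoid X]` under Mathlib's
`FreeAlgebra.equivMonoidAlgebraFreeMonoid`. [folklore] -/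
theorem equivMonoidAlgebraFreeMonoid_freeMonoidLift (w : FreeMonoid X) :
    FreeAlgebra.equivMonoidAlgebraFreeMonoid
        (FreeMonoid.lift (FreeAlgebra.ι R) w : FreeAlgebra R X) =
      MonoidAlgebra.of R (FreeMonoid X) w := by
  have h : ((FreeAlgebra.equivMonoidAlgebraFreeMonoid :
        FreeAlgebra R X ≃ₐ[R] MonoidAlgebra R (FreeMonoid X)) :
          FreeAlgebra R X →* MonoidAlgebra R (FreeMonoid X)).comp
        (FreeMonoid.lift (FreeAlgebra.ι R)) = MonoidAlgebra.of R (FreeMonoid X) :=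
    FreeMonoid.hom_eq fun x => by
      show FreeAlgebra.equivMonoidAlgebraFreeMonoid
        (FreeMonoid.lift (FreeAlgebra.ι R) (FreeMonoid.of x)) = _
      rw [FreeMonoid.lift_eval_of]
      show FreeAlgebra.lift R _ (FreeAlgebra.ι R x) = _
      rw [FreeAlgebra.lift_ι_apply]
  exact DFunLike.congr_fun h w

/-- **A non-commutative polynomial is the sum of its coefficients times its words**:
`P = Σ_{w ∈ supp P} coeff_w(P) • w` in `FreeAlgebra R X`, the coefficients being read in the
monoid-algebra model `R[FreeMonoid X]` (`FreeAlgebra.equivMonoidAlgebraFreeMonoid`). [folklore] -/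
theorem eq_sum_coeff_smul_freeMonoidLift (P : FreeAlgebra R X) :
    P = ∑ w ∈ (FreeAlgebra.equivMonoidAlgebraFreeMonoid P).coeff.support,
      (FreeAlgebra.equivMonoidAlgebraFreeMonoid P).coeff w •
        (FreeMonoid.lift (FreeAlgebra.ι R) w : FreeAlgebra R X) := by
  apply (FreeAlgebra.equivMonoidAlgebraFreeMonoid (R := R) (X := X)).injective
  rw [map_sum]
  simp_rw [map_smul, equivMonoidAlgebraFreeMonoid_freeMonoidLift, MonoidAlgebra.of_apply,
    MonoidAlgebra.smul_single', mul_one]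
  apply MonoidAlgebra.ext
  rw [MonoidAlgebra.coeff_sum]
  simp_rw [MonoidAlgebra.coeff_single]
  exact (Finsupp.sum_single _).symm

/-- Evaluation of a word under `FreeAlgebra.lift`: `(lift T)(w) = T^w := FreeMonoid.lift T w` (the
product of the letters `T_j` along `w`). [folklore] -/
theorem freeAlgebra_lift_freeMonoidLift {A : Type*} [Semiring A] [Algebra R A] (T : X → A)
    (w : FreeMonoid X) :
    FreeAlgebra.lift R T (FreeMonoid.lift (FreeAlgebra.ι R) w) = FreeMonoid.lift T w := by
  have h : ((FreeAlgebra.lift R T : FreeAlgebra R X →ₐ[R] A) : FreeAlgebra R X →* A).comp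
      (FreeMonoid.lift (FreeAlgebra.ι R)) = FreeMonoid.lift T :=
    FreeMonoid.hom_eq fun x => by
      show FreeAlgebra.lift R T (FreeMonoid.lift (FreeAlgebra.ι R) (FreeMonoid.of x)) = _
      rw [FreeMonoid.lift_eval_of, FreeAlgebra.lift_ι_apply, FreeMonoid.lift_eval_of]
  exact DFunLike.congr_fun h w

/-- Evaluation of a word under `FreeRing.lift`: `(lift T)(w) = T^w` for the word `w` multiplied
out in the free ring (`FreeMonoid.lift FreeRing.of w`). [folklore] -/
theorem freeRing_lift_freeMonoidLift {A : Type*} [Ring A] (T : X → A) (w : FreeMonoid X) :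
    FreeRing.lift T (FreeMonoid.lift FreeRing.of w) = FreeMonoid.lift T w := by
  have h : ((FreeRing.lift T : FreeRing X →+* A) : FreeRing X →* A).comp
      (FreeMonoid.lift FreeRing.of) = FreeMonoid.lift T :=
    FreeMonoid.hom_eq fun x => by
      show FreeRing.lift T (FreeMonoid.lift FreeRing.of (FreeMonoid.of x)) = _
      rw [FreeMonoid.lift_eval_of, FreeRing.lift_of, FreeMonoid.lift_eval_of]
  exact DFunLike.congr_fun h w

end Words

/-- A `σ`-semilinear map `θ` commuting with the letters `T_j ↦ T'_j` commutes with every word in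
them: `θ (T^w x) = T'^w (θ x)`. [folklore] -/
theorem semilinear_apply_freeMonoidLift {R S M M' : Type*} [Semiring R] [Semiring S]
    {σ : R →+* S} [AddCommMonoid M] [Module R M] [AddCommMonoid M'] [Module S M']
    (θ : M →ₛₗ[σ] M') {X : Type*} (T : X → Module.End R M) (T' : X → Module.End S M')
    (hT : ∀ (j : X) (x : M), θ (T j x) = T' j (θ x)) (w : FreeMonoid X) (x : M) :
    θ (FreeMonoid.lift T w x) = FreeMonoid.lift T' w (θ x) := by
  induction w using FreeMonoid.inductionOn' generalizing x with
  | one => simp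
  | mul_of b a ih =>
    rw [map_mul, map_mul, FreeMonoid.lift_eval_of, FreeMonoid.lift_eval_of, Module.End.mul_apply,
      Module.End.mul_apply, hT, ih]

/-! ### 3. Galois descent of `Aut`-stable subspaces over `ℚ̄_p` -/

/-- **An `Aut(k)`-stable subspace of `k^ι` is spanned by its rational vectors, for any field `k`
abstractly isomorphic to `ℂ`** (transport of the tree's
`Complex.submodule_le_span_fixed_of_forall_ringEquiv`, the case `F = ℚ`, along `e : k ≃+* ℂ`: the
image `{w | e⁻¹ ∘ w ∈ V} ⊆ ℂ^ι` is an `Aut(ℂ)`-stable `ℂ`-subspace, and `e⁻¹` maps rational vectors to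
rational vectors). [cite: Borel1991, AG §14.2] -/
theorem submodule_le_span_rat_of_forall_ringEquiv {k : Type*} [Field k] (e : k ≃+* ℂ)
    {ι : Type*} [Fintype ι] (V : Submodule k (ι → k))
    (hV : ∀ σ : k ≃+* k, ∀ v ∈ V, (⇑σ ∘ v) ∈ V) :
    V ≤ Submodule.span k {w | w ∈ V ∧ ∀ i, w i ∈ Set.range ((↑) : ℚ → k)} := by
  classical
  -- the countable subfield `ℚ ⊆ ℂ`
  set F : Subfield ℂ := (Rat.castHom ℂ).fieldRange with hFdef
  have hF : #F ≤ ℵ₀ := by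
    refine (Cardinal.mk_le_of_surjective (Rat.castHom ℂ).rangeRestrictField_bijective.2).trans ?_
    simp
  have hmemF : ∀ {y : ℂ}, y ∈ F ↔ ∃ q : ℚ, (q : ℂ) = y := fun {y} => RingHom.mem_fieldRange
  -- transport of `V` to `ℂ^ι`
  let V' : Submodule ℂ (ι → ℂ) :=
    { carrier := {w | (⇑e.symm ∘ w) ∈ V}
      add_mem' := fun {a b} ha hb => by
        have h : (⇑e.symm ∘ (a + b)) = (⇑e.symm ∘ a) + (⇑e.symm ∘ b) := funext fun i => by simp
        show (⇑e.symm ∘ (a + b)) ∈ V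
        rw [h]
        exact V.add_mem ha hb
      zero_mem' := by
        have h : (⇑e.symm ∘ (0 : ι → ℂ)) = 0 := funext fun i => by simp
        show (⇑e.symm ∘ (0 : ι → ℂ)) ∈ V
        rw [h]
        exact V.zero_mem
      smul_mem' := fun c w hw => by
        have h : (⇑e.symm ∘ (c • w)) = e.symm c • (⇑e.symm ∘ w) := funext fun i => by simp
        show (⇑e.symm ∘ (c • w)) ∈ V
        rw [h]
        exact V.smul_mem _ hw }
  have hmemV' : ∀ w : ι → ℂ, w ∈ V' ↔ (⇑e.symm ∘ w) ∈ V := fun w => Iff.rfl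
  -- `V'` is stable under `Aut(ℂ)`
  have hV' : ∀ ρ : ℂ ≃+* ℂ, (∀ x ∈ F, ρ x = x) → ∀ w ∈ V', (⇑ρ ∘ w) ∈ V' := by
    intro ρ _ w hw
    rw [hmemV'] at hw ⊢
    have h : (⇑e.symm ∘ (⇑ρ ∘ w)) = ⇑(e.trans (ρ.trans e.symm)) ∘ (⇑e.symm ∘ w) :=
      funext fun i => by simp
    rw [h]
    exact hV _ _ hw
  -- descend over `ℂ` and pull back along `e⁻¹`
  intro v hv
  have hw : (⇑e ∘ v) ∈ V' := by
    rw [hmemV']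
    have h : (⇑e.symm ∘ (⇑e ∘ v)) = v := funext fun i => by simp
    rwa [h]
  have hspan := Complex.submodule_le_span_fixed_of_forall_ringEquiv F hF V' hV' hw
  have key : ∀ w ∈ Submodule.span ℂ {w : ι → ℂ | w ∈ V' ∧ ∀ i, w i ∈ F},
      (⇑e.symm ∘ w) ∈ Submodule.span k {w | w ∈ V ∧ ∀ i, w i ∈ Set.range ((↑) : ℚ → k)} := by
    intro w hw'
    induction hw' using Submodule.span_induction with
    | mem w hw' =>
      refine Submodule.subset_span ⟨(hmemV' w).1 hw'.1, fun i => ?_⟩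
      obtain ⟨q, hq⟩ := hmemF.1 (hw'.2 i)
      exact ⟨q, by simp [← hq]⟩
    | zero =>
      have h : (⇑e.symm ∘ (0 : ι → ℂ)) = 0 := funext fun i => by simp
      rw [h]
      exact Submodule.zero_mem _
    | add a b _ _ ha hb =>
      have h : (⇑e.symm ∘ (a + b)) = (⇑e.symm ∘ a) + (⇑e.symm ∘ b) := funext fun i => by simp
      rw [h]
      exact Submodule.add_mem _ ha hb
    | smul c a _ ha =>
      have h : (⇑e.symm ∘ (c • a)) = e.symm c • (⇑e.symm ∘ a) := funext fun i => by simp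
      rw [h]
      exact Submodule.smul_mem _ _ ha
  have h := key _ hspan
  have h' : (⇑e.symm ∘ (⇑e ∘ v)) = v := funext fun i => by simp
  rwa [h'] at h

/-- **Galois descent over `ℚ̄_p`: an `Aut(ℚ̄_p)`-stable subspace of `ℚ̄_p^ι` (`ι` finite) is spanned
by its rational vectors** (`ℚ̄_p = PadicAlgCl p`; via `ℚ̄_p ≃ ℂ`, `PadicAlgCl.nonempty_ringEquiv_complex`,
and the descent over `ℂ`). [cite: Borel1991, AG §14.2] -/
theorem padicAlgCl_submodule_le_span_rat (p : ℕ) [Fact p.Prime] {ι : Type*} [Fintype ι]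
    (V : Submodule (PadicAlgCl p) (ι → PadicAlgCl p))
    (hV : ∀ σ : PadicAlgCl p ≃+* PadicAlgCl p, ∀ v ∈ V, (⇑σ ∘ v) ∈ V) :
    V ≤ Submodule.span (PadicAlgCl p)
      {w | w ∈ V ∧ ∀ i, w i ∈ Set.range ((↑) : ℚ → PadicAlgCl p)} := by
  obtain ⟨e⟩ := PadicAlgCl.nonempty_ringEquiv_complex p
  exact submodule_le_span_rat_of_forall_ringEquiv e V hV

/-! ### 4. Integral refinement: integer vectors of a subspace form a direct summand of `ℤ^ι` -/

/-- **Integral refinement of rational relations.** Let `V ⊆ L^ι` (`L` a field of characteristic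
`0`, `ι` finite) be a subspace and `v ∈ V` an `L`-combination of RATIONAL vectors of `V`. Then
`v = Σ_i v_i • Q_i` with INTEGER vectors `Q_i ∈ ℤ^ι ∩ V` — the coefficients being the coordinates
`v_i` of `v` themselves.  Proof: `Λ = ℤ^ι ∩ V` is saturated (`d z ∈ Λ, d ≠ 0 ⇒ z ∈ Λ`), so in a
Smith normal form (`Submodule.smithNormalForm`, `ℤ` a PID) `Λ = ⊕_{j ∈ J} ℤ a_j b_j ⊆ ⊕_{j ∈ J} ℤ b_j`
one has `b_j ∈ Λ` (`j ∈ J`): `Λ` is the direct summand `⊕_{j ∈ J} ℤ b_j` of `ℤ^ι`, with projection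
`π` onto `⊕_{j ∉ J} ℤ b_j` (`π(Λ) = 0`, `z − π z ∈ Λ`); the `L`-linear extension of `π` kills every
rational vector of `V` (a multiple of one lies in `Λ`), hence `v`, and
`v = Σ_i v_i e_i = Σ_i v_i (e_i − π e_i) + π_L v`. [folklore] -/
theorem exists_int_combination_of_mem_span_rat {L : Type*} [Field L] [CharZero L]
    {ι : Type*} [Fintype ι] [DecidableEq ι] (V : Submodule L (ι → L)) {v : ι → L}
    (hv : v ∈ Submodule.span L {w | w ∈ V ∧ ∀ i, w i ∈ Set.range ((↑) : ℚ → L)}) :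
    ∃ Q : ι → ι → ℤ, (∀ i, (fun j => (Q i j : L)) ∈ V) ∧
      v = ∑ i, v i • fun j => (Q i j : L) := by
  classical
  -- integer vectors inside `L^ι`
  let cast : (ι → ℤ) →ₗ[ℤ] (ι → L) :=
    LinearMap.pi fun i => (Int.castAddHom L).toIntLinearMap ∘ₗ LinearMap.proj i
  have cast_apply : ∀ (z : ι → ℤ) (j : ι), cast z j = (z j : L) := fun z j => rfl
  -- the lattice `Λ` of integer vectors of `V`; it is saturated
  let Λ : Submodule ℤ (ι → ℤ) := (V.restrictScalars ℤ).comap cast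
  have hmemΛ : ∀ z, z ∈ Λ ↔ cast z ∈ V := fun z => Iff.rfl
  have hsat : ∀ (d : ℤ) (z : ι → ℤ), d ≠ 0 → d • z ∈ Λ → z ∈ Λ := by
    intro d z hd hdz
    rw [hmemΛ] at hdz ⊢
    rw [map_zsmul, ← Int.cast_smul_eq_zsmul L] at hdz
    have h := V.smul_mem ((d : L)⁻¹) hdz
    rwa [smul_smul, inv_mul_cancel₀ (Int.cast_ne_zero.2 hd), one_smul] at h
  -- a Smith normal form of `Λ ≤ ℤ^ι`: a basis `bM` of `ℤ^ι` such that multiples `a_i • bM (f i)`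
  -- form a basis of `Λ`; by saturation `bM (f i) ∈ Λ`, so `Λ` is a direct summand and the
  -- projection `π` onto `⊕_{j ∉ range f} ℤ bM j` kills exactly `Λ`
  obtain ⟨nΛ, snf⟩ := Submodule.smithNormalForm (Pi.basisFun ℤ ι) Λ
  let π : (ι → ℤ) →ₗ[ℤ] (ι → ℤ) :=
    snf.bM.constr ℤ fun j => if j ∈ Set.range snf.f then (0 : ι → ℤ) else snf.bM j
  have hπb : ∀ j, π (snf.bM j) = if j ∈ Set.range snf.f then (0 : ι → ℤ) else snf.bM j :=
    fun j => snf.bM.constr_basis ℤ _ j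
  have hπΛ : ∀ z ∈ Λ, π z = 0 := by
    intro z hz
    rw [← snf.bM.sum_repr z, map_sum]
    refine Finset.sum_eq_zero fun j _ => ?_
    rw [map_smul, hπb]
    split_ifs with hj
    · rw [smul_zero]
    · rw [snf.repr_eq_zero_of_notMem_range ⟨z, hz⟩ hj, zero_smul]
  have hbMΛ : ∀ i, snf.bM (snf.f i) ∈ Λ := by
    intro i
    have ha : snf.a i ≠ 0 := by
      intro h0
      have h1 := snf.snf i
      rw [h0, zero_smul] at h1
      exact snf.bN.ne_zero i (Subtype.ext h1)
    refine hsat (snf.a i) _ ha ?_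
    rw [← snf.snf i]
    exact (snf.bN i).2
  have hπ : ∀ z, z - π z ∈ Λ := by
    intro z
    have hz : z - π z =
        ∑ j, (if j ∈ Set.range snf.f then snf.bM.repr z j • snf.bM j else 0) := by
      conv_lhs => rw [← snf.bM.sum_repr z]
      rw [map_sum, ← Finset.sum_sub_distrib]
      refine Finset.sum_congr rfl fun j _ => ?_
      rw [map_smul, hπb]
      split_ifs <;> simp
    rw [hz]
    refine Submodule.sum_mem _ fun j _ => ?_
    split_ifs with hj
    · obtain ⟨i, rfl⟩ := hj
      exact Λ.smul_mem _ (hbMΛ i)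
    · exact Λ.zero_mem
  -- the `L`-linear extension `πL` of `π`
  let πL : (ι → L) →ₗ[L] (ι → L) :=
    Matrix.toLin' ((LinearMap.toMatrix' π).map (Int.castRingHom L))
  have hπL : ∀ z, πL (cast z) = cast (π z) := fun z => by
    funext i
    show Matrix.mulVec ((LinearMap.toMatrix' π).map (Int.castRingHom L))
        (⇑(Int.castRingHom L) ∘ z) i = (Int.castRingHom L) (π z i)
    rw [← RingHom.map_mulVec, LinearMap.toMatrix'_mulVec]
  -- `πL` kills the rational vectors of `V`, hence `v`
  have hker : {w | w ∈ V ∧ ∀ i, w i ∈ Set.range ((↑) : ℚ → L)} ⊆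
      (LinearMap.ker πL : Set (ι → L)) := by
    rintro w ⟨hwV, hwQ⟩
    choose c hc using hwQ
    -- a common denominator `d` and the integer vector `z = d w`
    let d : ℕ := ∏ i, (c i).den
    have hd : (d : L) ≠ 0 := by
      have h0 : d ≠ 0 := Finset.prod_ne_zero_iff.2 fun i _ => (c i).den_ne_zero
      exact_mod_cast h0
    let z : ι → ℤ := fun i => (c i).num * ∏ j ∈ Finset.univ.erase i, ((c j).den : ℤ)
    have hzq : ∀ i, (z i : ℚ) = c i * d := by
      intro i
      simp only [z, d, Int.cast_mul, Int.cast_prod, Int.cast_natCast, Nat.cast_prod]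
      rw [← Finset.mul_prod_erase Finset.univ (fun j => ((c j).den : ℚ)) (Finset.mem_univ i),
        ← mul_assoc, Rat.mul_den_eq_num]
    have hz : cast z = (d : L) • w := by
      funext i
      rw [cast_apply, Pi.smul_apply, smul_eq_mul, ← hc i, ← Rat.cast_intCast, hzq i, Rat.cast_mul,
        Rat.cast_natCast, mul_comm]
    have hzΛ : z ∈ Λ := by
      rw [hmemΛ, hz]
      exact V.smul_mem _ hwV
    have h0 : (d : L) • πL w = 0 := by
      rw [← map_smul, ← hz, hπL, hπΛ z hzΛ, map_zero]
    exact LinearMap.mem_ker.2 ((smul_eq_zero.1 h0).resolve_left hd)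
  have hv0 : πL v = 0 := LinearMap.mem_ker.1 (Submodule.span_le.2 hker hv)
  -- the decomposition `v = ∑ i, v i • (e_i - π e_i)`
  refine ⟨fun i => Pi.single i 1 - π (Pi.single i 1), fun i => (hmemΛ _).1 (hπ _), ?_⟩
  have hbasis : ∀ i, cast (Pi.single i 1) = Pi.single i (1 : L) := fun i => by
    funext j
    rw [cast_apply, Pi.single_apply, Pi.single_apply]
    split_ifs <;> simp
  have hsum : ∑ i, v i • cast (Pi.single i 1 - π (Pi.single i 1)) = v - πL v := by
    simp only [map_sub, smul_sub, Finset.sum_sub_distrib, ← hπL, hbasis, ← map_smul, ← map_sum]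
    have hv' : ∑ i, v i • Pi.single i (1 : L) = v := by
      funext j
      simp [Finset.sum_apply, Pi.single_apply]
    rw [hv']
  rw [hv0, sub_zero] at hsum
  exact hsum.symm

/-! ### 5. The named fact -/

/-- **`ResGLnCohomology.heckeRelations_definedOverInt` holds: the Hecke relations on a finite family
of receptacles `H^{q_k}(S_{K_f(𝔫)}, Ẽ_{λ_k}(ℚ̄_p))` of `Res_{K/ℚ} GL_n` with parallel weights are
defined over `ℤ`.** Parallel weights are constant in the embedding (an embedding `K →+* ℚ̄_p`
exists); writing `P = Σ_{w ∈ S} c_w w` (`eq_sum_coeff_smul_freeMonoidLift`), the coefficient vectors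
`v ∈ ℚ̄_p^S` with `Σ_w v_w T^w = 0` on every `M_k` form a subspace `V ∋ c`, stable under
`Aut(ℚ̄_p)` because the surjective `σ`-semilinear Hecke-equivariant `θ_σ = σ^*`
(`exists_semilinear_heckeSymmetry`) satisfies `θ_σ ∘ (Σ v_w T^w) = (Σ σ(v_w) T^w) ∘ θ_σ`; by Galois
descent (`padicAlgCl_submodule_le_span_rat`) `c` is a combination of rational vectors of `V`, and by
the integral refinement (`exists_int_combination_of_mem_span_rat`) `c = Σ_s c_s Q_s` with integer
relations `Q_s`, read in `ℤ⟨X⟩ = FreeRing` through `freeRing_lift_freeMonoidLift`; the coefficients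
`c_s` are coefficients of `P`, of norm `≤ 1`.
[cite: GrobnerRaghuram2014, §7.1 Lemma 37 and §7.2 Lemma 38 with σ^*] -/
theorem heckeRelations_definedOverInt_holds : heckeRelations_definedOverInt := by
  intro n K _ _ p _ 𝔫 _ m lams qs hpar r ix _ P hint hrel
  classical
  -- parallel weights are constant in `τ`
  obtain ⟨τ₀⟩ : Nonempty (K →+* PadicAlgCl p) := inferInstance
  obtain ⟨μ, rfl⟩ : ∃ μ : Fin m → Fin n → ℤ, lams = fun k _ => μ k :=
    ⟨fun k => lams k τ₀, funext fun k => funext fun τ => hpar k τ τ₀⟩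
  -- the letters `T_{k,j} = T_{v_j,i_j}` on the `k`-th receptacle
  let T : ∀ k : Fin m, Fin r →
      Module.End (PadicAlgCl p) (levelCohomology (PadicAlgCl p) n K 𝔫 (fun _ => μ k) (qs k)) :=
    fun k j => heckeT (PadicAlgCl p) n K 𝔫 (fun _ => μ k) (qs k) (ix j).1 (ix j).2
  -- the coefficients of `P` and their (finite) support `ι`
  set c := (FreeAlgebra.equivMonoidAlgebraFreeMonoid P).coeff with hc
  let ι : Type := ↥c.support
  -- words as free-algebra monomials, and the polynomial with prescribed coefficients on `ι`
  let wd : ι → FreeAlgebra (PadicAlgCl p) (Fin r) :=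
    fun s => FreeMonoid.lift (FreeAlgebra.ι (PadicAlgCl p)) s.1
  let poly : (ι → PadicAlgCl p) →ₗ[PadicAlgCl p] FreeAlgebra (PadicAlgCl p) (Fin r) :=
    ∑ s : ι, (LinearMap.proj s : (ι → PadicAlgCl p) →ₗ[PadicAlgCl p] PadicAlgCl p).smulRight (wd s)
  have poly_apply : ∀ v : ι → PadicAlgCl p, poly v = ∑ s, v s • wd s := fun v => by
    simp only [poly, LinearMap.coe_sum, Finset.sum_apply, LinearMap.smulRight_apply,
      LinearMap.coe_proj, Function.eval]
  -- `P = poly c`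
  let v₀ : ι → PadicAlgCl p := fun s => c s
  have hP : P = poly v₀ := by
    rw [poly_apply, eq_sum_coeff_smul_freeMonoidLift (PadicAlgCl p) P, ← hc]
    exact (Finset.sum_coe_sort c.support
      (fun w => c w • (FreeMonoid.lift (FreeAlgebra.ι (PadicAlgCl p)) w :
        FreeAlgebra (PadicAlgCl p) (Fin r)))).symm
  -- evaluation: `lift T_k (poly v) = Σ_s v_s T_k^{w_s}`
  have hlift : ∀ (k : Fin m) (v : ι → PadicAlgCl p),
      FreeAlgebra.lift (PadicAlgCl p) (T k) (poly v) = ∑ s, v s • FreeMonoid.lift (T k) s.1 := by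
    intro k v
    rw [poly_apply, map_sum]
    refine Finset.sum_congr rfl fun s _ => ?_
    rw [map_smul, freeAlgebra_lift_freeMonoidLift]
  -- the space `V` of coefficient vectors of relations on the family; `c ∈ V`
  let V : Submodule (PadicAlgCl p) (ι → PadicAlgCl p) :=
    ⨅ k : Fin m, LinearMap.ker ((FreeAlgebra.lift (PadicAlgCl p) (T k)).toLinearMap ∘ₗ poly)
  have hmemV : ∀ v, v ∈ V ↔ ∀ k, FreeAlgebra.lift (PadicAlgCl p) (T k) (poly v) = 0 := fun v => by
    simp only [V, Submodule.mem_iInf, LinearMap.mem_ker, LinearMap.coe_comp, Function.comp_apply,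
      AlgHom.toLinearMap_apply]
  have hv₀ : v₀ ∈ V := (hmemV v₀).2 fun k => by
    rw [← hP]
    exact hrel k
  -- `V` is `Aut(ℚ̄_p)`-stable: `θ_σ ∘ (Σ v_s T^{w_s}) = (Σ σ(v_s) T^{w_s}) ∘ θ_σ`, `θ_σ` surjective
  have hV : ∀ σ : PadicAlgCl p ≃+* PadicAlgCl p, ∀ v ∈ V, (⇑σ ∘ v) ∈ V := by
    intro σ v hv
    rw [hmemV] at hv ⊢
    intro k
    obtain ⟨θ, hθsurj, hθT⟩ := exists_semilinear_heckeSymmetry σ n K 𝔫 (μ k) (qs k)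
    refine LinearMap.ext fun y => ?_
    obtain ⟨x, rfl⟩ := hθsurj y
    have hcomm : θ (FreeAlgebra.lift (PadicAlgCl p) (T k) (poly v) x) =
        FreeAlgebra.lift (PadicAlgCl p) (T k) (poly (⇑σ ∘ v)) (θ x) := by
      rw [hlift, hlift, LinearMap.sum_apply, LinearMap.sum_apply, map_sum]
      refine Finset.sum_congr rfl fun s _ => ?_
      rw [LinearMap.smul_apply, LinearMap.smul_apply, map_smulₛₗ, Function.comp_apply,
        semilinear_apply_freeMonoidLift θ (T k) (T k) (fun j z => hθT _ z) s.1 x]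
      rfl
    rw [← hcomm, hv k, LinearMap.zero_apply, map_zero, LinearMap.zero_apply]
  -- Galois descent and integral refinement
  obtain ⟨Q, hQV, hQ⟩ :=
    exists_int_combination_of_mem_span_rat V (padicAlgCl_submodule_le_span_rat p V hV hv₀)
  -- the integer relations, as elements of `ℤ⟨X⟩ = FreeRing (Fin r)`
  let qR : ι → FreeRing (Fin r) := fun s => ∑ t : ι, (Q s t) • FreeMonoid.lift FreeRing.of t.1
  have hqR_lift : ∀ {A : Type} [Ring A] (f : Fin r → A) (s : ι),
      FreeRing.lift f (qR s) = ∑ t : ι, (Q s t) • FreeMonoid.lift f t.1 := fun f s => by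
    simp only [qR, map_sum, map_zsmul, freeRing_lift_freeMonoidLift]
  -- conclusion, reindexed by `Fin |ι|`
  let e := Fintype.equivFin ι
  refine ⟨Fintype.card ι, fun i => v₀ (e.symm i), fun i => qR (e.symm i), fun i => hint _,
    fun i k => ?_, ?_⟩
  · -- each `Q_s` is a relation on every `M_k`
    have h := (hmemV _).1 (hQV (e.symm i)) k
    rw [hlift] at h
    rw [hqR_lift]
    simpa only [Int.cast_smul_eq_zsmul] using h
  · -- `P = Σ_i c_i • Q_i`
    calc P = poly v₀ := hP
      _ = ∑ s : ι, v₀ s • poly (fun t => (Q s t : PadicAlgCl p)) := by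
          conv_lhs => rw [hQ]
          rw [map_sum]
          simp_rw [map_smul]
      _ = ∑ s : ι, v₀ s • FreeRing.lift (FreeAlgebra.ι (PadicAlgCl p)) (qR s) := by
          refine Finset.sum_congr rfl fun s _ => ?_
          rw [hqR_lift, poly_apply]
          simp_rw [Int.cast_smul_eq_zsmul]
          rfl
      _ = ∑ i : Fin (Fintype.card ι),
            v₀ (e.symm i) • FreeRing.lift (FreeAlgebra.ι (PadicAlgCl p)) (qR (e.symm i)) :=
          (e.symm.sum_comp (fun s => v₀ s • FreeRing.lift (FreeAlgebra.ι (PadicAlgCl p)) (qR s))).symm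

end ResGLnCohomology

end Literature.NumberTheory.Automorphic

end
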